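import Mathlib.Algebra.Module.Basic
import Mathlib.Tactic.LinearCombination
import Mathlib.Tactic.Abel
import HarnessLib

/-!
# Venture HSemireg — door (I), TRIPLE-PIN anatomy: when are the three seed lines of a slot concurrent?

Kernel form of the incidence arithmetic behind `step0/B/ANATOMY-CASEA-s0-2.md` §5 (1) and the «conc» column of
`step0/B/out/conj/STAB-TABLE.txt` (cell pub-hsemireg, seat s0-2).  In one slot `S = E × E` (`E = E_ω`) the three seed
lines of a TRIPLE-PIN class are the diagonal `y = x` (a slot line of `X = Γ₁³`), `y = ω x + c` (of `Y1`) and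
`y = ω² x + d` (of `Y2`).  The diagonal meets `y = ω x + c` exactly in the points `(x, x)` with `(1 - ω) x = c`; such a
point lies on `y = ω² x + d` iff `d = -ω² c` — independently of WHICH solution `x` was taken.  Hence the three lines are
concurrent iff `d = -ω² c` (given that `(1 - ω) x = c` is solvable, which on an elliptic curve it always is, `1 - ω` being
an isogeny).  The classes with this relation in all three slots are the six «CCC» classes tri000 ∕ 006 ∕ 043 ∕ 049 ∕ 203 ∕ 209
of the campaign; tri209 (all three slots off-grid) closed last on both encoders.  The NEGATION — `d ≠ -ω² c`, the three
pairwise intersections pairwise disjoint — is the «non-concurrent» half of the EASY-SLOT test of `step0/B/RESULT-B21.md` §2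
(`no_common_point`, `concurrent_or_disjoint`).

ABSTRACT SETTING.  Any commutative ring `R` with an element `ω` satisfying `ω² + ω + 1 = 0` (so `ω³ = 1`), acting on any
`R`-module `M` (for the campaign: `R = ℤ[ω]`, `M = E_ω(ℂ)` or its torsion).  Points of the slot are pairs; only the
identity `(1 - ω²) = -ω² (1 - ω)` is used.

HONEST FRAMING.  Linear algebra over `ℤ[ω]`-modules only; no SAT encoding, no cycle, nothing here bears on HC ∕ HC_CM ∕ HC_AV.
-/

namespace Summit.Ventures.HSemireg
namespace SeedLineConcurrency

variable {R M : Type*} [CommRing R] [AddCommGroup M] [Module R M]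

/-- `ω² + ω + 1 = 0` implies `ω³ = 1`. -/
theorem omega_cube (ω : R) (hω : ω ^ 2 + ω + 1 = 0) : ω ^ 3 = 1 := by
  linear_combination (ω - 1) * hω

/-- The key identity: on the diagonal point `(x, x)`, the defect of the `ω²`-line is `-ω²` times the defect of the
`ω`-line: `x - ω² x = -ω² (x - ω x)`. -/
theorem defect_omega_sq (ω : R) (hω : ω ^ 2 + ω + 1 = 0) (x : M) :
    x - ω ^ 2 • x = -(ω ^ 2) • (x - ω • x) := by
  have h3 : ω ^ 3 = 1 := omega_cube ω hω
  rw [smul_sub, smul_smul, show -ω ^ 2 * ω = -ω ^ 3 by ring1, h3, neg_one_smul, neg_smul, sub_neg_eq_add]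
  abel

/-- CONCURRENCY CRITERION (pointwise form).  If the diagonal point `(x, x)` lies on the line `y = ω x + c`
(i.e. `x - ω x = c`), then it lies on `y = ω² x + d` iff `d = -ω² c`. -/
theorem on_third_line_iff (ω : R) (hω : ω ^ 2 + ω + 1 = 0) {x c : M} (hx : x - ω • x = c) (d : M) :
    x - ω ^ 2 • x = d ↔ d = -(ω ^ 2) • c := by
  rw [defect_omega_sq ω hω x, hx]
  exact eq_comm

/-- CONCURRENCY CRITERION (line form).  Suppose the diagonal meets the `ω`-line, i.e. some `x₀` has `x₀ - ω x₀ = c`.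
Then the three lines `y = x`, `y = ω x + c`, `y = ω² x + d` have a common point iff `d = -ω² c`; and in that case
EVERY intersection point of the first two lies on the third. -/
theorem concurrent_iff (ω : R) (hω : ω ^ 2 + ω + 1 = 0) {c : M} (hsol : ∃ x₀ : M, x₀ - ω • x₀ = c) (d : M) :
    (∃ x : M, x - ω • x = c ∧ x - ω ^ 2 • x = d) ↔ d = -(ω ^ 2) • c := by
  constructor
  · rintro ⟨x, hx, hxd⟩
    exact (on_third_line_iff ω hω hx d).mp hxd
  · intro hd
    obtain ⟨x₀, hx₀⟩ := hsol
    exact ⟨x₀, hx₀, (on_third_line_iff ω hω hx₀ d).mpr hd⟩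

/-- All-or-nothing: when `d = -ω² c`, every point of (diagonal ∩ ω-line) is on the `ω²`-line — the three seed lines of a
concurrent slot share ALL their pairwise intersection points (three of them on `E_ω`, a coset of `E[1 - ω]`). -/
theorem all_meeting_points_on_third (ω : R) (hω : ω ^ 2 + ω + 1 = 0) {c d : M} (hd : d = -(ω ^ 2) • c)
    {x : M} (hx : x - ω • x = c) : x - ω ^ 2 • x = d :=
  (on_third_line_iff ω hω hx d).mpr hd

/-- NON-CONCURRENT CASE (the «easy ∕ hard slot» test of RESULT-B21 §2): if `d ≠ -ω² c` then NO point lies on all three seed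
lines — every diagonal point of the `ω`-line misses the `ω²`-line — so the three pairwise intersections are pairwise disjoint
(on `E_ω`: nine distinct points instead of three shared ones). -/
theorem no_common_point (ω : R) (hω : ω ^ 2 + ω + 1 = 0) {c d : M} (hd : d ≠ -(ω ^ 2) • c)
    {x : M} (hx : x - ω • x = c) : x - ω ^ 2 • x ≠ d :=
  fun hxd => hd ((on_third_line_iff ω hω hx d).mp hxd)

/-- Dichotomy packaged: given that the diagonal meets the `ω`-line, EITHER `d = -ω² c` and every meeting point of those two lies on
the third line, OR `d ≠ -ω² c` and none does. -/
theorem concurrent_or_disjoint (ω : R) (hω : ω ^ 2 + ω + 1 = 0) (c d : M) :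
    (d = -(ω ^ 2) • c ∧ ∀ x : M, x - ω • x = c → x - ω ^ 2 • x = d) ∨
    (d ≠ -(ω ^ 2) • c ∧ ∀ x : M, x - ω • x = c → x - ω ^ 2 • x ≠ d) := by
  by_cases hd : d = -(ω ^ 2) • c
  · exact Or.inl ⟨hd, fun x hx => all_meeting_points_on_third ω hω hd hx⟩
  · exact Or.inr ⟨hd, fun x hx => no_common_point ω hω hd hx⟩

end SeedLineConcurrency
end Summit.Ventures.HSemireg
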